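import Summits.CriticalPhenomena.PercolationContinuityZ3.Theorems.PercNearOneGluingNoHeavyLowerTailKNGoodTwoMarkCells
import HarnessLib

/-!
# `NoHeavyLowerTail` (stmt-CriticalPhenomena-4575) — the two-mark cluster inequality on the principal filter
# (prim-hp-2 gen 26, MEMO-gen26 §4 (4b)–(4c); part 2 of 2)

Support file (`--supports stmt-CriticalPhenomena-4575`, hull-port prover `prim-hp-2`, gen 26).  No definitions, no
named facts, no sorries; standard axioms.

Setting: Bernoulli bond percolation with arbitrary edge probabilities `w` on a finite vertex type (`μ = prodBernoulli w`),
four vertices `s` (source), `x` (avoided), `o`, `a` (marks).  Write `Q = μ(· | s ↮ x)`, `C_s` for the open cluster of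
`s`, `p = Q(a ∈ C_s)` and `κ_M = μ(o ↔ a | a ↮ s, a ↮ x, s ↮ x)` (the probability that `o` hangs on `a` in the world where
`a, s, x` are pairwise separated).  The conjectured inequality (II) of MEMO-gen26 §3 — the endpoint of Kozma–Nitzan's box for
the cluster-domination form of their pre-FKG inequality (3) at `|A| = 3` — says that for every increasing function `U` of
`C_s`, `Cov_Q(1{o ∈ C_s}, U) ≥ κ_M · Cov_Q(1{a ∈ C_s}, U)`.  This file PROVES it for the indicator of every up-family `𝒰` of
vertex sets all of whose members contain `a` (the principal filter of `{a ∈ C_s}`; in all numerics the binding direction):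

* `KNGoodTwoMark.phi_one` — (4b) = (Φ1), denominator-free:
  `μ(D∩OD)·μ(R)·μ(M) ≥ μ(R∩O)·μ(D)·μ(M) + μ(K)·μ(D)·μ(M∩{a~o})`;
* `KNGoodTwoMark.filter_tilt` — (4c): for every up-family `𝒰` with `a ∈ W` for all `W ∈ 𝒰`,
  `μ(R∩O∩E)·μ(R)·μ(M) ≥ μ(R∩O)·μ(R∩E)·μ(M) + μ({s↮a}∩{s↮x})·μ(M ∩ {a~o})·μ(R∩E)`
  (`R = {s↮x}`, `O = {s~o}`, `E = {C_s ∈ 𝒰}`), i.e. `Q(o ∈ C_s | C_s ∈ 𝒰) ≥ Q(o ∈ C_s) + Q(a ∉ C_s)·κ_M`.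

Ingredients: part 1 (`…KNGoodTwoMarkCells.lean`: set-source BHK steps, `superadditive_M`) and Kozma–Nitzan's disjoint-union
identity on `M` (`KNLemma2.conn_union_inter_eq`).
[cite: VandenbergHaggstromKahn2005, Thms. 1.1–1.5 (pp. 3–8)] [cite: KozmaNitzan2024, §2.2 Lemmas 1–2 (pp. 5–6), §3 (pp. 7–12)]
-/

noncomputable section

namespace Summit.CriticalPhenomena.PercolationContinuityZ3.Theorems

open MeasureTheory Set Literature.Probability.LatticeModels Literature.Probability.Percolation
open scoped Classical

namespace KNGoodTwoMark

variable {V : Type*} [Fintype V]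

/-- **(4b) = (Φ1), denominator-free.**  With `R = {s↮x}`, `K = {s↮a} ∩ {s↮x}`, `M = K ∩ {a↮x}`, `D = {a↮x} ∩ {s↮x}`,
`O = {s~o}`, `OD = {a~o} ∪ {s~o}`:
`μ(D ∩ OD) · μ(R) · μ(M) ≥ μ(R ∩ O) · μ(D) · μ(M) + μ(K) · μ(D) · μ(M ∩ {a~o})`,
i.e. `μ(o ∈ C_a ∪ C_s | {a,s} ↮ x) ≥ Q(o ∈ C_s) + Q(a ∉ C_s) · κ_M`.
[cite: KozmaNitzan2024, Lemmas 1–2 (pp. 5–6)] [cite: VandenbergHaggstromKahn2005, Thms. 1.2–1.5 (pp. 5–8)] -/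
theorem phi_one (w : Sym2 V → unitInterval) (o a s x : V) :
    (prodBernoulli w).real ({ω : BondConfig V | ¬ (openGraph ω).Reachable s x} ∩ {ω | (openGraph ω).Reachable s o}) *
        (prodBernoulli w).real {ω : BondConfig V | ¬ (openGraph ω).Reachable a x ∧ ¬ (openGraph ω).Reachable s x} *
        (prodBernoulli w).real {ω : BondConfig V | (¬ (openGraph ω).Reachable s a ∧ ¬ (openGraph ω).Reachable s x) ∧
          ¬ (openGraph ω).Reachable a x} +
      (prodBernoulli w).real {ω : BondConfig V | ¬ (openGraph ω).Reachable s a ∧ ¬ (openGraph ω).Reachable s x} *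
        (prodBernoulli w).real {ω : BondConfig V | ¬ (openGraph ω).Reachable a x ∧ ¬ (openGraph ω).Reachable s x} *
        (prodBernoulli w).real ({ω : BondConfig V | (¬ (openGraph ω).Reachable s a ∧ ¬ (openGraph ω).Reachable s x) ∧
            ¬ (openGraph ω).Reachable a x} ∩ {ω | (openGraph ω).Reachable a o}) ≤
    (prodBernoulli w).real ({ω : BondConfig V | ¬ (openGraph ω).Reachable a x ∧ ¬ (openGraph ω).Reachable s x} ∩
        {ω | (openGraph ω).Reachable a o ∨ (openGraph ω).Reachable s o}) *
      (prodBernoulli w).real {ω : BondConfig V | ¬ (openGraph ω).Reachable s x} *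
      (prodBernoulli w).real {ω : BondConfig V | (¬ (openGraph ω).Reachable s a ∧ ¬ (openGraph ω).Reachable s x) ∧
          ¬ (openGraph ω).Reachable a x} := by
  set μ := prodBernoulli w with hμ
  set R : Set (BondConfig V) := {ω | ¬ (openGraph ω).Reachable s x} with hR
  set D : Set (BondConfig V) := {ω | ¬ (openGraph ω).Reachable a x ∧ ¬ (openGraph ω).Reachable s x} with hD
  set OD : Set (BondConfig V) := {ω | (openGraph ω).Reachable a o ∨ (openGraph ω).Reachable s o} with hOD
  set A : Set (BondConfig V) := {ω | (openGraph ω).Reachable s a} with hA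
  set K : Set (BondConfig V) := {ω | ¬ (openGraph ω).Reachable s a ∧ ¬ (openGraph ω).Reachable s x} with hK
  set M : Set (BondConfig V) := {ω | (¬ (openGraph ω).Reachable s a ∧ ¬ (openGraph ω).Reachable s x) ∧
      ¬ (openGraph ω).Reachable a x} with hM
  set O : Set (BondConfig V) := {ω | (openGraph ω).Reachable s o} with hO
  set Oa : Set (BondConfig V) := {ω | (openGraph ω).Reachable a o} with hOa
  set NAX : Set (BondConfig V) := {ω | ¬ (openGraph ω).Reachable a x} with hNAX
  -- the scalars
  set rA := μ.real (R ∩ A) with hrA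
  set rAO := μ.real (R ∩ A ∩ O) with hrAO
  set k := μ.real K with hk
  set kO := μ.real (K ∩ O) with hkO
  set m := μ.real M with hm
  set mOs := μ.real (M ∩ O) with hmOs
  set mOa := μ.real (M ∩ Oa) with hmOa
  -- set identities
  have hRA : R ∩ Aᶜ = K := by
    ext ω; simp only [hR, hA, hK, Set.mem_inter_iff, Set.mem_compl_iff, Set.mem_setOf_eq]; tauto
  have hDA : D ∩ A = R ∩ A := by
    ext ω
    simp only [hR, hA, hD, Set.mem_inter_iff, Set.mem_setOf_eq]
    constructor
    · rintro ⟨⟨_, hsx⟩, hsa⟩; exact ⟨hsx, hsa⟩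
    · rintro ⟨hsx, hsa⟩; exact ⟨⟨fun hax => hsx (hsa.trans hax), hsx⟩, hsa⟩
  have hDAc : D ∩ Aᶜ = M := by
    ext ω; simp only [hD, hA, hM, Set.mem_inter_iff, Set.mem_compl_iff, Set.mem_setOf_eq]; tauto
  have hDODA : D ∩ OD ∩ A = R ∩ A ∩ O := by
    ext ω
    simp only [hR, hA, hO, hD, hOD, Set.mem_inter_iff, Set.mem_setOf_eq]
    constructor
    · rintro ⟨⟨⟨_, hsx⟩, hod⟩, hsa⟩
      refine ⟨⟨hsx, hsa⟩, ?_⟩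
      rcases hod with hao | hso
      · exact hsa.trans hao
      · exact hso
    · rintro ⟨⟨hsx, hsa⟩, hso⟩
      exact ⟨⟨⟨fun hax => hsx (hsa.trans hax), hsx⟩, Or.inr hso⟩, hsa⟩
  have hDODAc : D ∩ OD ∩ Aᶜ = OD ∩ M := by
    ext ω; simp only [hD, hA, hM, hOD, Set.mem_inter_iff, Set.mem_compl_iff, Set.mem_setOf_eq]; tauto
  have hKNAX : K ∩ NAX = M := by
    ext ω; simp only [hK, hNAX, hM, Set.mem_inter_iff, Set.mem_setOf_eq]
  have hKONAX : K ∩ (O ∩ NAX) = M ∩ O := by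
    ext ω; simp only [hK, hNAX, hM, hO, Set.mem_inter_iff, Set.mem_setOf_eq]; tauto
  have hMsub : M ⊆ {ω | ∀ s' ∈ ({a} : Set V), ∀ t ∈ ({s} : Set V), ¬ (openGraph ω).Reachable s' t} := by
    intro ω hω
    simp only [Set.mem_setOf_eq, Set.mem_singleton_iff, forall_eq]
    simp only [hM, Set.mem_setOf_eq] at hω
    exact fun has => hω.1.1 has.symm
  -- decompositions of the scalars
  have hr : μ.real R = rA + k := by rw [real_split μ R A, hRA]
  have hrO : μ.real (R ∩ O) = rAO + kO := by
    rw [real_split μ (R ∩ O) A]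
    have e1 : R ∩ O ∩ A = R ∩ A ∩ O := by ext ω; simp only [Set.mem_inter_iff]; tauto
    have e2 : R ∩ O ∩ Aᶜ = K ∩ O := by rw [← hRA]; ext ω; simp only [Set.mem_inter_iff]; tauto
    rw [e1, e2]
  have hd : μ.real D = rA + m := by rw [real_split μ D A, hDA, hDAc]
  have hdOD : μ.real (D ∩ OD) = rAO + (mOa + mOs) := by
    rw [real_split μ (D ∩ OD) A, hDODA, hDODAc]
    congr 1
    have key := KNLemma2.conn_union_inter_eq μ ({a} : Set V) ({s} : Set V) o M hMsub
    rw [conn_union_eq, conn_single_eq, conn_single_eq] at key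
    rw [key, hmOa, hmOs]
    congr 1 <;> (congr 1; ext ω; simp only [Set.mem_inter_iff]; tauto)
  -- the two inequalities
  have hii : kO * m ≤ k * mOs := by
    have key := lemma1_step w o a s x
    rw [← hK, ← hO, ← hNAX, hKNAX, hKONAX] at key
    exact key
  have hiii : rA * (mOa + mOs) ≤ rAO * m := by
    have key := superadditive_M w o a s x
    rw [← hD, ← hA, ← hOD, ← hM, ← hO] at key
    -- key : μ(D∩A)·μ(M∩OD) ≤ μ(D∩(A∩O))·μ(M)
    rw [hDA] at key
    have e1 : D ∩ (A ∩ O) = R ∩ A ∩ O := by rw [← Set.inter_assoc, hDA]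
    rw [e1] at key
    have e2 : μ.real (M ∩ OD) = mOa + mOs := by
      have key2 := KNLemma2.conn_union_inter_eq μ ({a} : Set V) ({s} : Set V) o M hMsub
      rw [conn_union_eq, conn_single_eq, conn_single_eq] at key2
      rw [Set.inter_comm, key2, hmOa, hmOs]
      congr 1 <;> (congr 1; ext ω; simp only [Set.mem_inter_iff]; tauto)
    rw [e2] at key
    linarith
  have hkm : m ≤ k := by
    rw [hm, hk]; exact measureReal_mono (by rw [← hKNAX]; exact Set.inter_subset_left)
  have hrA0 : 0 ≤ rA := measureReal_nonneg
  have hm0 : 0 ≤ m := measureReal_nonneg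
  -- the algebra
  rw [hr, hrO, hd, hdOD]
  have ident : (rAO + (mOa + mOs)) * (rA + k) * m - ((rAO + kO) * (rA + m) * m + k * (rA + m) * mOa) =
      (k - m) * (rAO * m - rA * (mOa + mOs)) + (rA + m) * (k * mOs - kO * m) := by ring
  nlinarith [mul_nonneg (sub_nonneg.2 hkm) (sub_nonneg.2 hiii), mul_nonneg (add_nonneg hrA0 hm0) (sub_nonneg.2 hii)]

/-- **(4c) THEOREM — the two-mark inequality (II) on the principal filter of `{a ∈ C_s}`.**  For Bernoulli bond
percolation with arbitrary edge probabilities on a finite graph, vertices `s, x, o, a`, and ANY up-family `𝒰` of vertex sets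
all containing `a`: with `R = {s ↮ x}`, `O = {s ~ o}`, `E = {C_s ∈ 𝒰}` (`C_s` = the vertex cluster of `s`),
`M = {s ↮ a} ∩ {s ↮ x} ∩ {a ↮ x}`,
  `μ(R ∩ O) · μ(R ∩ E) · μ(M) + μ({s↮a} ∩ {s↮x}) · μ(M ∩ {a ~ o}) · μ(R ∩ E) ≤ μ(R ∩ O ∩ E) · μ(R) · μ(M)`,
i.e. (dividing by `μ(R)² μ(M)`):  `Q(o ∈ C_s | C_s ∈ 𝒰) ≥ Q(o ∈ C_s) + Q(a ∉ C_s) · μ(o ↔ a | M)`, `Q = μ(· | s ↮ x)` —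
conditioning the cluster of `s` on an up-event forcing `a` into it raises the probability of containing `o` by at least
`Q(a ∉ C_s)` times the probability that `o` hangs on `a` in the separated world.  Equivalently
`Cov_Q(1{o∈C_s}, 1_E) ≥ κ_M · Cov_Q(1{a∈C_s}, 1_E)` — inequality (II) of MEMO-gen26 for these `E` (the tight direction:
`𝒰 = {W ∋ a}` is Kozma–Nitzan's Lemma 1 + Lemma 2).
[cite: VandenbergHaggstromKahn2005, Thms. 1.1–1.5 (pp. 3–8)] [cite: KozmaNitzan2024, §2.2 Lemmas 1–2 (pp. 5–6)] -/
theorem filter_tilt (w : Sym2 V → unitInterval) (o a s x : V) (𝒰 : Set (Set V))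
    (hU : ∀ W ∈ 𝒰, ∀ W' : Set V, W ⊆ W' → W' ∈ 𝒰) (haU : ∀ W ∈ 𝒰, a ∈ W) :
    (prodBernoulli w).real ({ω : BondConfig V | ¬ (openGraph ω).Reachable s x} ∩ {ω | (openGraph ω).Reachable s o}) *
        (prodBernoulli w).real ({ω : BondConfig V | ¬ (openGraph ω).Reachable s x} ∩
          {ω | {v | (openGraph ω).Reachable s v} ∈ 𝒰}) *
        (prodBernoulli w).real {ω : BondConfig V | (¬ (openGraph ω).Reachable s a ∧ ¬ (openGraph ω).Reachable s x) ∧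
          ¬ (openGraph ω).Reachable a x} +
      (prodBernoulli w).real {ω : BondConfig V | ¬ (openGraph ω).Reachable s a ∧ ¬ (openGraph ω).Reachable s x} *
        (prodBernoulli w).real ({ω : BondConfig V | (¬ (openGraph ω).Reachable s a ∧ ¬ (openGraph ω).Reachable s x) ∧
            ¬ (openGraph ω).Reachable a x} ∩ {ω | (openGraph ω).Reachable a o}) *
        (prodBernoulli w).real ({ω : BondConfig V | ¬ (openGraph ω).Reachable s x} ∩
          {ω | {v | (openGraph ω).Reachable s v} ∈ 𝒰}) ≤
    (prodBernoulli w).real ({ω : BondConfig V | ¬ (openGraph ω).Reachable s x} ∩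
        ({ω | (openGraph ω).Reachable s o} ∩ {ω | {v | (openGraph ω).Reachable s v} ∈ 𝒰})) *
      (prodBernoulli w).real {ω : BondConfig V | ¬ (openGraph ω).Reachable s x} *
      (prodBernoulli w).real {ω : BondConfig V | (¬ (openGraph ω).Reachable s a ∧ ¬ (openGraph ω).Reachable s x) ∧
          ¬ (openGraph ω).Reachable a x} := by
  set μ := prodBernoulli w with hμ
  set R : Set (BondConfig V) := {ω | ¬ (openGraph ω).Reachable s x} with hR
  set D : Set (BondConfig V) := {ω | ¬ (openGraph ω).Reachable a x ∧ ¬ (openGraph ω).Reachable s x} with hD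
  set OD : Set (BondConfig V) := {ω | (openGraph ω).Reachable a o ∨ (openGraph ω).Reachable s o} with hOD
  set K : Set (BondConfig V) := {ω | ¬ (openGraph ω).Reachable s a ∧ ¬ (openGraph ω).Reachable s x} with hK
  set M : Set (BondConfig V) := {ω | (¬ (openGraph ω).Reachable s a ∧ ¬ (openGraph ω).Reachable s x) ∧
      ¬ (openGraph ω).Reachable a x} with hM
  set O : Set (BondConfig V) := {ω | (openGraph ω).Reachable s o} with hO
  set Oa : Set (BondConfig V) := {ω | (openGraph ω).Reachable a o} with hOa
  set E : Set (BondConfig V) := {ω | {v | (openGraph ω).Reachable s v} ∈ 𝒰} with hE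
  -- on `E`, `s ~ a`
  have hEa : ∀ ω ∈ E, (openGraph ω).Reachable s a := by
    intro ω hω
    simp only [hE, Set.mem_setOf_eq] at hω
    exact haU _ hω
  have hDE : D ∩ E = R ∩ E := by
    ext ω
    simp only [hD, hR, Set.mem_inter_iff, Set.mem_setOf_eq]
    constructor
    · rintro ⟨⟨_, hsx⟩, he⟩; exact ⟨hsx, he⟩
    · rintro ⟨hsx, he⟩
      exact ⟨⟨fun hax => hsx ((hEa ω he).trans hax), hsx⟩, he⟩
  have hDODE : D ∩ (OD ∩ E) = R ∩ (O ∩ E) := by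
    ext ω
    simp only [hD, hR, hO, hOD, Set.mem_inter_iff, Set.mem_setOf_eq]
    constructor
    · rintro ⟨⟨_, hsx⟩, hod, he⟩
      refine ⟨hsx, ?_, he⟩
      rcases hod with hao | hso
      · exact (hEa ω he).trans hao
      · exact hso
    · rintro ⟨hsx, hso, he⟩
      exact ⟨⟨fun hax => hsx ((hEa ω he).trans hax), hsx⟩, Or.inr hso, he⟩
  -- (i): set-BHK with the up-family
  have hi := bhk_pair_upfamily w o a s x 𝒰 hU
  rw [← hD, ← hOD, ← hE, hDE, hDODE] at hi
  -- (4b)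
  have hphi := phi_one w o a s x
  rw [← hR, ← hO, ← hD, ← hM, ← hK, ← hOa, ← hOD] at hphi
  -- scalars
  have h1 : 0 ≤ μ.real (R ∩ E) := measureReal_nonneg
  have h2 : 0 ≤ μ.real R := measureReal_nonneg
  have h3 : 0 ≤ μ.real M := measureReal_nonneg
  have h4 : 0 ≤ μ.real D := measureReal_nonneg
  have h5 : 0 ≤ μ.real (R ∩ (O ∩ E)) := measureReal_nonneg
  have hREle : μ.real (R ∩ E) ≤ μ.real D := by
    rw [← hDE]; exact measureReal_mono Set.inter_subset_left
  by_cases hd : μ.real D = 0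
  · have hRE : μ.real (R ∩ E) = 0 := le_antisymm (hd ▸ hREle) h1
    rw [hRE]; simp only [mul_zero, zero_mul, zero_add]
    exact mul_nonneg (mul_nonneg h5 h2) h3
  have hdpos : 0 < μ.real D := lt_of_le_of_ne h4 (Ne.symm hd)
  -- combine: d·[goal LHS] ≤ d·[goal RHS]
  have step1 : μ.real (D ∩ OD) * μ.real (R ∩ E) * (μ.real R * μ.real M) ≤
      μ.real D * μ.real (R ∩ (O ∩ E)) * (μ.real R * μ.real M) :=
    mul_le_mul_of_nonneg_right hi (mul_nonneg h2 h3)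
  have step2 : (μ.real (R ∩ O) * μ.real D * μ.real M + μ.real K * μ.real D * μ.real (M ∩ Oa)) * μ.real (R ∩ E) ≤
      μ.real (D ∩ OD) * μ.real R * μ.real M * μ.real (R ∩ E) :=
    mul_le_mul_of_nonneg_right hphi h1
  have key : μ.real D * (μ.real (R ∩ O) * μ.real (R ∩ E) * μ.real M +
        μ.real K * μ.real (M ∩ Oa) * μ.real (R ∩ E)) ≤
      μ.real D * (μ.real (R ∩ (O ∩ E)) * μ.real R * μ.real M) := by nlinarith [step1, step2]
  exact le_of_mul_le_mul_left key hdpos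

end KNGoodTwoMark

end Summit.CriticalPhenomena.PercolationContinuityZ3.Theorems
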